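import Summits.CriticalPhenomena.PercolationContinuityZ3.Theorems.SahiMasterFamilyHFlat

/-!
# Slot decoupling of H♭: the hybrid functional, the typed conjecture SDH♭ ("one union-closed family against one hull point"),
# and the kernel reduction `SDH♭(k) ⟹ H♭(k) ⟹ (UC-hull)_k`

Unit `prim-masterthm-p4` (gen 18; crux anchor stmt-CriticalPhenomena-4575, helper work; memo
`run/shared/lean/prim/prim-masterthm/prim-masterthm-p4/P4-GEN18-REPORT.md` §3 and `DELETION-PICTURE.md` §2).  Companion of `…HFlat` (gen 18:
the typed conjecture `HFlatNonneg k` = H♭(k): `Σ_t β_{t}·Φ_k(cap_t β) ≤ k·Φ_k(β)` on the union-closed hull, `H♯ ⟹ H♭ ⟹ (UC-hull)`).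

THE DECOUPLING IDENTITY (kernel, `k_mul_phiSet_eq_sum_blockCoef`, `hFlat_lhs_eq_mixture_lam`).  Summing Lieb–Sahi's block expansion
[LiebSahi2021, Prop. 3.4] of `Φ_k(β) = E_k(realW β; realF)` over the distinguished index gives, for EVERY set function `β`,
   `k·Φ_k(β) = Σ_{∅≠B} |B|!·β_B·κ_B(β)`,   `κ_B(β) := coRest (realW β) realF B`  (`= 1` for `B = univ`, `= −Φ_{Bᶜ}(β|_{Bᶜ})` otherwise),
and `κ_B(β)` does NOT depend on `β_B`.  Hence for a mixture `β = Σ_x w_x 1_{𝒰_x}` the left side of H♭ splits slot by slot: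
   `k·Φ_k(β) − Σ_t β_{t}·Φ_k(cap_t β) = Σ_x w_x · Λ(𝒰_x, β)`,   `Λ(𝒢, β) := Σ_{B∈𝒢} |B|!·κ_B(β) − Σ_{t : {t}∈𝒢} Φ_k(cap_t β)`
(`lam`; in the memo's notation `Λ(𝒢, d) = k! − Σ_{B∈𝒢, B≠univ} |B|!·Φ_{Bᶜ}(β|) − Σ_{{t}∈𝒢} W_{[k]∖t}(d)`, linear in the indicator of `𝒢`, multiaffine in `β`).

**CONJECTURE SDH♭(k)** (`SDHFlatNonneg k`, conjecture-valued definition, never a fact): `Λ(𝒢, β) ≥ 0` for EVERY union-closed family `𝒢 ∋ univ`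
and EVERY point `β` of the union-closed hull — the family `𝒢` and the hull point `β` UNRELATED.  **`SDH♭(k) ⟹ H♭(k)`** (`hFlatNonneg_of_sdhFlatNonneg`,
average the identity over the slots `x` with `𝒢 = 𝒰_x`) **`⟹ (UC-hull)_k ⟹ (GH)_k`**.  EVIDENCE (memo §3): 0 violations on all 2271² vertex pairs and
≈ 680 000 (family, hull point) pairs at k = 4, 91 500 pairs at k = 5, and minimum 0 under coordinate-descent minimisation over the pairwise-subadditive
relaxation `{d : d_{A∪B} ≤ d_A + d_B}` (k = 4, 5); FALSE for `β` an arbitrary point of the box (k = 4), so the hull structure of `β` is used; at VERTEX pairs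
(`β = 1_𝒱`) it is elementary (each `κ_B(1_𝒱) ≤ 0` for `B ≠ univ` by (V) and vanishing, so `Λ` is antitone in `𝒢`).  Its localisation LOC′ (one union-closed
family and one subadditive set function, memo §4) implies it.  HONEST FRAMING: a reformulation-born conjecture and a kernel REDUCTION; nothing here proves
(UC-hull)_k for a new k; (UC-hull)_k (k ≥ 8), H♯ (k ≥ 4), H♭ (k ≥ 4), SDH♭ (k ≥ 4), Sahi's `C_k`, Kahn's Conjecture 5 and the master theorem remain OPEN.
Axioms standard. [this work]
-/

noncomputable section

open scoped Classical

namespace Summit.CriticalPhenomena.PercolationContinuityZ3.Theorems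

namespace SDHFlat

open Finset
open Literature.Combinatorics.Sahi2008
open Literature.Combinatorics.Sahi2008.CycleForm (coRest)
open PrincipalCapBeta (phiSet realW realF ex_realW_prod phiSet_eq_sahiE_real)
open GHConjecture (UCHullNonneg)
open HFlat (HFlatNonneg)

variable {k : ℕ}

/-- The block coefficient `κ_B(β) := coRest (realW β) realF B` of Lieb–Sahi's block expansion in the canonical signed model of `β`:
`= 1` for `B = univ` and `= −Φ_{Bᶜ}(β|_{Bᶜ})` (the Sahi functional of the restriction of `β` to the complement) otherwise; it does not
involve `β_B`. [this work] -/
def blockCoef (β : Finset (Fin k) → ℝ) (B : Finset (Fin k)) : ℝ := coRest (realW β) realF B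

/-- `κ_univ(β) = 1`. [this work] -/
theorem blockCoef_univ (β : Finset (Fin k) → ℝ) : blockCoef β univ = 1 :=
  CycleForm.coRest_univ _ _

/-- **`κ_B(β) = −Φ_{Bᶜ}(β|_{Bᶜ})` for `B ≠ univ`**: minus an honest sub-functional of `β` avoiding `B` (re-indexed by an embedding into `Bᶜ`;
`PrincipalCapStep.coRest_realF_eq`). [this work] -/
theorem blockCoef_eq_neg_phiSet_map (β : Finset (Fin (k + 1)) → ℝ) {B : Finset (Fin (k + 1))} (hBu : B ≠ univ) :
    ∃ (n : ℕ) (e : Fin (n + 1) ↪ Fin (k + 1)), (∀ j, e j ∉ B) ∧ blockCoef β B = -phiSet (n + 1) (fun S => β (S.map e)) :=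
  PrincipalCapStep.coRest_realF_eq β hBu

/-- The HYBRID functional of a family `𝒢` at `β`: `hyb(𝒢, β) := Σ_{B∈𝒢} |B|·(|B|−1)!·κ_B(β)` (`= Σ_{B∈𝒢, B≠∅} |B|!·κ_B(β)`; the empty set, if
present, contributes nothing).  `k·Φ^{hyb}` of the memo: the block through a uniformly random index is judged by `𝒢`, the rest by `β`. [this work] -/
def hyb (𝒢 : Finset (Finset (Fin k))) (β : Finset (Fin k) → ℝ) : ℝ :=
  ∑ B ∈ 𝒢, ((B.card : ℝ) * ((B.card - 1).factorial : ℝ)) * blockCoef β B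

/-- **`Λ(𝒢, β) := hyb(𝒢, β) − Σ_{t : {t} ∈ 𝒢} Φ_k(cap_t β)`** — the decoupled H♭ functional of one family against one point. [this work] -/
def lam (𝒢 : Finset (Finset (Fin k))) (β : Finset (Fin k) → ℝ) : ℝ :=
  hyb 𝒢 β - ∑ t : Fin k, (if ({t} : Finset (Fin k)) ∈ 𝒢 then (1 : ℝ) else 0) * phiSet k (fun S => if t ∈ S then 1 else β S)

/-- **Conjecture SDH♭(k)** — slot-decoupled H♭: for every union-closed family `𝒢 ∋ univ` and every finite mixture `β` of indicators of
union-closed families containing `univ` (the two unrelated), `0 ≤ Λ(𝒢, β)`.  A conjecture-valued definition, never a fact. [this work]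
[status: open k ≥ 4; verified on all vertex pairs and ≈ 7·10⁵ hull pairs at k = 4, 9·10⁴ at k = 5; false off the hull] -/
@[conjecture] def SDHFlatNonneg (k : ℕ) : Prop :=
  ∀ (α : Type) [Fintype α] (w : α → ℝ) (𝒰 : α → Finset (Finset (Fin k))),
    (∀ x, 0 ≤ w x) → ∑ x, w x = 1 → (∀ x, ∀ A ∈ 𝒰 x, ∀ A' ∈ 𝒰 x, A ∪ A' ∈ 𝒰 x) → (∀ x, univ ∈ 𝒰 x) →
      ∀ 𝒢 : Finset (Finset (Fin k)), (∀ A ∈ 𝒢, ∀ A' ∈ 𝒢, A ∪ A' ∈ 𝒢) → univ ∈ 𝒢 →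
        0 ≤ lam 𝒢 (fun S => ∑ x, w x * (if S ∈ 𝒰 x then (1 : ℝ) else 0))

/-! ### The block expansion summed over the distinguished index -/

/-- **`(k+1)·Φ_{k+1}(β) = Σ_B |B|·(|B|−1)!·β_B·κ_B(β)`** for every set function `β` (Lieb–Sahi's block expansion along the index `i`, in the
canonical signed model `Φ = E(realW β; realF)`, summed over `i`). [this work] -/
theorem k_mul_phiSet_eq_sum_blockCoef (β : Finset (Fin (k + 1)) → ℝ) :
    ((k + 1 : ℕ) : ℝ) * phiSet (k + 1) β =
      ∑ B : Finset (Fin (k + 1)), ((B.card : ℝ) * ((B.card - 1).factorial : ℝ)) * (β B * blockCoef β B) := by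
  have hk : 1 ≤ k + 1 := Nat.succ_le_succ (Nat.zero_le k)
  -- block expansion along each index `i`
  have hexp : ∀ i : Fin (k + 1), phiSet (k + 1) β =
      ∑ B : Finset (Fin (k + 1)), if i ∈ B then ((B.card - 1).factorial : ℝ) * (β B * blockCoef β B) else 0 := by
    intro i
    rw [phiSet_eq_sahiE_real, CycleForm.sahiE_eq_sum_blocks (realW β) hk realF i, sum_filter]
    refine sum_congr rfl fun B _ => ?_
    split_ifs with hi
    · have e1 : (fun x => ∏ j ∈ B, realF j x) = ∏ j ∈ B, (realF j : Finset (Fin (k + 1)) → ℝ) := by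
        funext x; exact (Finset.prod_apply x B realF).symm
      rw [e1, ex_realW_prod]
      rfl
    · rfl
  calc ((k + 1 : ℕ) : ℝ) * phiSet (k + 1) β = ∑ _i : Fin (k + 1), phiSet (k + 1) β := by
        rw [sum_const, card_univ, Fintype.card_fin, nsmul_eq_mul]
    _ = ∑ i : Fin (k + 1), ∑ B : Finset (Fin (k + 1)),
          (if i ∈ B then ((B.card - 1).factorial : ℝ) * (β B * blockCoef β B) else 0) := sum_congr rfl fun i _ => hexp i
    _ = ∑ B : Finset (Fin (k + 1)), ∑ i : Fin (k + 1),
          (if i ∈ B then ((B.card - 1).factorial : ℝ) * (β B * blockCoef β B) else 0) := sum_comm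
    _ = ∑ B : Finset (Fin (k + 1)), ((B.card : ℝ) * ((B.card - 1).factorial : ℝ)) * (β B * blockCoef β B) := by
        refine sum_congr rfl fun B _ => ?_
        rw [sum_ite_mem, univ_inter, sum_const, nsmul_eq_mul]
        ring

/-! ### The decoupling identity for mixtures and `SDH♭ ⟹ H♭` -/

/-- **Decoupling identity.**  For a mixture `β = Σ_x w_x 1_{𝒰_x}`:
`(k+1)·Φ(β) − Σ_t β_{t}·Φ(cap_t β) = Σ_x w_x · Λ(𝒰_x, β)`. [this work] -/
theorem hFlat_lhs_eq_mixture_lam {α : Type} [Fintype α] (w : α → ℝ) (𝒰 : α → Finset (Finset (Fin (k + 1)))) :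
    ((k + 1 : ℕ) : ℝ) * phiSet (k + 1) (fun S => ∑ x, w x * (if S ∈ 𝒰 x then (1 : ℝ) else 0)) -
      ∑ t : Fin (k + 1), (∑ x, w x * (if ({t} : Finset (Fin (k + 1))) ∈ 𝒰 x then (1 : ℝ) else 0)) *
        phiSet (k + 1) (fun S => if t ∈ S then 1 else ∑ x, w x * (if S ∈ 𝒰 x then (1 : ℝ) else 0)) =
    ∑ x, w x * lam (𝒰 x) (fun S => ∑ x, w x * (if S ∈ 𝒰 x then (1 : ℝ) else 0)) := by
  set β : Finset (Fin (k + 1)) → ℝ := fun S => ∑ x, w x * (if S ∈ 𝒰 x then (1 : ℝ) else 0) with hβ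
  -- the hybrid part
  have h1 : ((k + 1 : ℕ) : ℝ) * phiSet (k + 1) β = ∑ x, w x * hyb (𝒰 x) β := by
    rw [k_mul_phiSet_eq_sum_blockCoef]
    have e : ∀ B : Finset (Fin (k + 1)), ((B.card : ℝ) * ((B.card - 1).factorial : ℝ)) * (β B * blockCoef β B) =
        ∑ x, w x * (((B.card : ℝ) * ((B.card - 1).factorial : ℝ)) * ((if B ∈ 𝒰 x then (1 : ℝ) else 0) * blockCoef β B)) := by
      intro B
      have : β B = ∑ x, w x * (if B ∈ 𝒰 x then (1 : ℝ) else 0) := rfl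
      rw [this, sum_mul, mul_sum]
      refine sum_congr rfl fun x _ => ?_
      ring
    rw [sum_congr rfl fun B _ => e B, sum_comm]
    refine sum_congr rfl fun x _ => ?_
    rw [← mul_sum]
    congr 1
    unfold hyb
    have e2 : ∀ B : Finset (Fin (k + 1)),
        ((B.card : ℝ) * ((B.card - 1).factorial : ℝ)) * ((if B ∈ 𝒰 x then (1 : ℝ) else 0) * blockCoef β B) =
          if B ∈ 𝒰 x then ((B.card : ℝ) * ((B.card - 1).factorial : ℝ)) * blockCoef β B else 0 := by
      intro B; split_ifs <;> ring
    rw [sum_congr rfl fun B _ => e2 B, sum_ite_mem, univ_inter]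
  -- the cap part
  have h2 : ∑ t : Fin (k + 1), (∑ x, w x * (if ({t} : Finset (Fin (k + 1))) ∈ 𝒰 x then (1 : ℝ) else 0)) *
        phiSet (k + 1) (fun S => if t ∈ S then 1 else β S) =
      ∑ x, w x * ∑ t : Fin (k + 1), (if ({t} : Finset (Fin (k + 1))) ∈ 𝒰 x then (1 : ℝ) else 0) *
        phiSet (k + 1) (fun S => if t ∈ S then 1 else β S) := by
    simp_rw [mul_sum, sum_mul]
    rw [sum_comm]
    refine sum_congr rfl fun x _ => sum_congr rfl fun t _ => ?_
    ring
  rw [h1, h2, ← sum_sub_distrib]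
  refine sum_congr rfl fun x _ => ?_
  unfold lam
  ring

/-- H♭(0) holds trivially (empty sum). [this work] -/
theorem hFlatNonneg_zero : HFlatNonneg 0 := by
  intro α _ w 𝒰 _ _ _ _
  simp

/-- **SDH♭(k) ⟹ H♭(k)**: average the decoupling identity over the slots. [this work] -/
theorem hFlatNonneg_of_sdhFlatNonneg (h : SDHFlatNonneg k) : HFlatNonneg k := by
  rcases Nat.eq_zero_or_pos k with hk | hk
  · subst hk; exact hFlatNonneg_zero
  · obtain ⟨k', rfl⟩ : ∃ k', k = k' + 1 := ⟨k - 1, (Nat.sub_add_cancel hk).symm⟩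
    intro α _ w 𝒰 hw0 hw1 hUC htop
    have hid := hFlat_lhs_eq_mixture_lam (k := k') w 𝒰
    have hnn : 0 ≤ ∑ x, w x * lam (𝒰 x) (fun S => ∑ x, w x * (if S ∈ 𝒰 x then (1 : ℝ) else 0)) :=
      sum_nonneg fun x _ => mul_nonneg (hw0 x) (h α w 𝒰 hw0 hw1 hUC htop (𝒰 x) (hUC x) (htop x))
    linarith [hid, hnn]

/-- Down the ladder: `SDH♭(k) ⟹ (UC-hull)_k`. [this work] -/
theorem ucHullNonneg_of_sdhFlatNonneg (h : SDHFlatNonneg k) : UCHullNonneg k :=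
  HFlat.ucHullNonneg_of_hFlatNonneg (hFlatNonneg_of_sdhFlatNonneg h)

/-- `SDH♭(k) ⟹ (GH)_k`. [this work] -/
theorem gSystemNonneg_of_sdhFlatNonneg (h : SDHFlatNonneg k) : GHConjecture.GSystemNonneg k :=
  GHConjecture.gSystemNonneg_of_ucHullNonneg (ucHullNonneg_of_sdhFlatNonneg h)

/-! ### The smallest family: `Λ({univ}, β) = k!` -/

/-- For `𝒢 = {univ}` (`k ≥ 2`, so that no singleton is `univ`): `Λ({univ}, β) = (k+2)·(k+1)! = (k+2)!`. [this work] -/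
theorem lam_singleton_univ (β : Finset (Fin (k + 2)) → ℝ) :
    lam {univ} β = ((k + 2 : ℕ) : ℝ) * ((k + 1).factorial : ℝ) := by
  unfold lam hyb
  have hne : ∀ t : Fin (k + 2), ({t} : Finset (Fin (k + 2))) ∉ ({univ} : Finset (Finset (Fin (k + 2)))) := by
    intro t ht
    rw [mem_singleton] at ht
    have h2 : (univ : Finset (Fin (k + 2))).card = 1 := by rw [← ht, card_singleton]
    rw [card_univ, Fintype.card_fin] at h2
    omega
  simp only [sum_singleton, blockCoef_univ, card_univ, Fintype.card_fin, mul_one, hne, if_false, zero_mul,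
    sum_const_zero, sub_zero]
  rw [show k + 2 - 1 = k + 1 by omega]

/-! ### APPENDED (gen 18, same day): `Λ(2^T, β) = 0` and SDH♭ at every VERTEX `β = 1_𝒱` (the elementary case)

`κ_B(β)` depends on `β` only through its values on the subsets of `Bᶜ` (`blockCoef_congr_off`), so `κ_B(cap_t β) = κ_B(β)` for `t ∈ B` and the
block expansion of `Φ(cap_t β)` at `t` reads `Φ_{k+1}(cap_t β) = Σ_{B∋t} (|B|−1)!·κ_B(β)` (`phiSet_cap_eq_sum_blockCoef`); summing over `t`,
`hyb(2^T, β) = Σ_t Φ(cap_t β)`, i.e. **`Λ(2^T, β) = 0` for every `β`** (`lam_univ_eq_zero`).  Hence `Λ(𝒢, β) = −Σ_{B∉𝒢} |B|(|B|−1)!·κ_B(β) + Σ_{t:{t}∉𝒢} Φ(cap_t β)`,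
and at a VERTEX `β = 1_𝒱` (`0/1`-valued, `β_univ = 1`, supermultiplicative — e.g. the indicator of a union-closed family containing `univ`) every
`κ_B(β) ≤ 0` for `B ≠ univ` ((V) / vanishing on the pulled-back family, `PhiVertex`) and every `Φ(cap_t β) ≥ 0`: **`Λ(𝒢, 1_𝒱) ≥ 0` for every `𝒢 ∋ univ`**
(`lam_nonneg_of_zero_one`; no union-closure of `𝒢` needed).  The content of SDH♭ is therefore entirely in MIXTURES. -/

/-- `κ_B(β)` only depends on the values of `β` on sets disjoint from `B`. [this work] -/
theorem blockCoef_congr_off {β β' : Finset (Fin (k + 1)) → ℝ} {B : Finset (Fin (k + 1))}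
    (h : ∀ S, Disjoint S B → β S = β' S) : blockCoef β B = blockCoef β' B := by
  by_cases hBu : B = univ
  · subst hBu; rw [blockCoef_univ, blockCoef_univ]
  · unfold blockCoef
    rw [CycleForm.coRest_of_ne_univ _ _ hBu, CycleForm.coRest_of_ne_univ _ _ hBu]
    congr 1
    unfold CycleForm.cycleSum CycleForm.cycleE
    refine sum_congr rfl fun τ _ => ?_
    congr 1
    refine prod_congr rfl fun O _ => ?_
    have e1 : ∀ γ : Finset (Fin (k + 1)) → ℝ,
        ex (realW γ) (fun x => ∏ i ∈ O, realF ((i : {x // x ∉ B}) : Fin (k + 1)) x) = γ (O.map (Function.Embedding.subtype _)) := by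
      intro γ
      have e2 : (fun x => ∏ i ∈ O, realF ((i : {x // x ∉ B}) : Fin (k + 1)) x) =
          ∏ j ∈ O.map (Function.Embedding.subtype _), (realF j : Finset (Fin (k + 1)) → ℝ) := by
        funext x
        rw [Finset.prod_apply, prod_map]
        rfl
      rw [e2, ex_realW_prod]
    rw [e1 β, e1 β']
    refine h _ (disjoint_left.2 fun y hy hyB => ?_)
    obtain ⟨i, _, rfl⟩ := mem_map.1 hy
    exact i.2 hyB

/-- `κ_B(cap_t β) = κ_B(β)` for `t ∈ B`. [this work] -/
theorem blockCoef_cap (β : Finset (Fin (k + 1)) → ℝ) {B : Finset (Fin (k + 1))} {t : Fin (k + 1)} (ht : t ∈ B) :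
    blockCoef (fun S => if t ∈ S then 1 else β S) B = blockCoef β B :=
  blockCoef_congr_off fun S hS => by rw [if_neg (disjoint_left.1 hS |> fun h' h'' => h' h'' ht)]

/-- **`Φ_{k+1}(cap_t β) = Σ_{B ∋ t} (|B|−1)!·κ_B(β)`** (block expansion of the capped function at `t`). [this work] -/
theorem phiSet_cap_eq_sum_blockCoef (β : Finset (Fin (k + 1)) → ℝ) (t : Fin (k + 1)) :
    phiSet (k + 1) (fun S => if t ∈ S then 1 else β S) =
      ∑ B : Finset (Fin (k + 1)), if t ∈ B then ((B.card - 1).factorial : ℝ) * blockCoef β B else 0 := by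
  have hk : 1 ≤ k + 1 := Nat.succ_le_succ (Nat.zero_le k)
  set γ : Finset (Fin (k + 1)) → ℝ := fun S => if t ∈ S then 1 else β S with hγ
  rw [phiSet_eq_sahiE_real, CycleForm.sahiE_eq_sum_blocks (realW γ) hk realF t, sum_filter]
  refine sum_congr rfl fun B _ => ?_
  split_ifs with htB
  · have e1 : (fun x => ∏ j ∈ B, realF j x) = ∏ j ∈ B, (realF j : Finset (Fin (k + 1)) → ℝ) := by
      funext x; exact (Finset.prod_apply x B realF).symm
    rw [e1, ex_realW_prod]
    have hγB : γ B = 1 := by simp only [hγ, if_pos htB]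
    have hκ : coRest (realW γ) realF B = blockCoef β B := blockCoef_cap β htB
    rw [hγB, hκ, one_mul]
  · rfl

/-- **`hyb(2^T, β) = Σ_t Φ_{k+1}(cap_t β)`**. [this work] -/
theorem hyb_univ_eq_sum_caps (β : Finset (Fin (k + 1)) → ℝ) :
    hyb (univ : Finset (Finset (Fin (k + 1)))) β = ∑ t : Fin (k + 1), phiSet (k + 1) (fun S => if t ∈ S then 1 else β S) := by
  unfold hyb
  calc ∑ B ∈ (univ : Finset (Finset (Fin (k + 1)))), ((B.card : ℝ) * ((B.card - 1).factorial : ℝ)) * blockCoef β B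
      = ∑ B : Finset (Fin (k + 1)), ∑ t : Fin (k + 1), (if t ∈ B then ((B.card - 1).factorial : ℝ) * blockCoef β B else 0) := by
        refine sum_congr rfl fun B _ => ?_
        rw [sum_ite_mem, univ_inter, sum_const, nsmul_eq_mul]
        ring
    _ = ∑ t : Fin (k + 1), ∑ B : Finset (Fin (k + 1)), (if t ∈ B then ((B.card - 1).factorial : ℝ) * blockCoef β B else 0) := sum_comm
    _ = ∑ t : Fin (k + 1), phiSet (k + 1) (fun S => if t ∈ S then 1 else β S) :=
        sum_congr rfl fun t _ => (phiSet_cap_eq_sum_blockCoef β t).symm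

/-- **`Λ(2^T, β) = 0` for every set function `β`.** [this work] -/
theorem lam_univ_eq_zero (β : Finset (Fin (k + 1)) → ℝ) : lam (univ : Finset (Finset (Fin (k + 1)))) β = 0 := by
  unfold lam
  rw [hyb_univ_eq_sum_caps]
  simp only [mem_univ, if_true, one_mul, sub_self]

/-- `κ_B(β) ≤ 0` for `B ≠ univ` at a `0/1`-valued supermultiplicative `β` ((V) on the pulled-back family, or vanishing). [this work] -/
theorem blockCoef_nonpos_of_zero_one (β : Finset (Fin (k + 1)) → ℝ) (h01 : ∀ B, β B = 0 ∨ β B = 1)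
    (hsup : ∀ S T, β S * β T ≤ β (S ∪ T)) {B : Finset (Fin (k + 1))} (hBu : B ≠ univ) : blockCoef β B ≤ 0 := by
  obtain ⟨n, e, _, hκ⟩ := blockCoef_eq_neg_phiSet_map β hBu
  rw [hκ, neg_nonpos]
  have h01' : ∀ S : Finset (Fin (n + 1)), β (S.map e) = 0 ∨ β (S.map e) = 1 := fun S => h01 _
  have h0' : ∀ S : Finset (Fin (n + 1)), 0 ≤ β (S.map e) := fun S => by rcases h01' S with h | h <;> simp [h]
  have hsup' : ∀ S T : Finset (Fin (n + 1)), β (S.map e) * β (T.map e) ≤ β ((S ∪ T).map e) := fun S T => by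
    rw [Finset.map_union]; exact hsup _ _
  rcases h01' univ with hz | ho
  · exact le_of_eq (PhiVertex.phiSet_eq_zero_of_univ_eq_zero (fun S => β (S.map e)) h0' hsup' hz).symm
  · exact PhiVertex.phiSet_nonneg_of_zero_one n (fun S => β (S.map e)) h01' ho hsup'

/-- **SDH♭ at the vertices (elementary case).**  For every family `𝒢 ∋ univ` (no union-closure needed) and every `0/1`-valued supermultiplicative
`β` (e.g. `β = 1_𝒱` for a union-closed `𝒱 ∋ univ`): `0 ≤ Λ(𝒢, β)`. [this work] -/
theorem lam_nonneg_of_zero_one (𝒢 : Finset (Finset (Fin (k + 1)))) (htop : univ ∈ 𝒢) (β : Finset (Fin (k + 1)) → ℝ)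
    (h01 : ∀ B, β B = 0 ∨ β B = 1) (hsup : ∀ S T, β S * β T ≤ β (S ∪ T)) : 0 ≤ lam 𝒢 β := by
  have h1 : ∀ B, β B ≤ 1 := fun B => by rcases h01 B with h | h <;> simp [h]
  have h0 := lam_univ_eq_zero β
  -- write both `lam 𝒢` and `lam univ` as sums over all sets / all points with indicators
  have ehyb : hyb 𝒢 β = ∑ B : Finset (Fin (k + 1)),
      (if B ∈ 𝒢 then ((B.card : ℝ) * ((B.card - 1).factorial : ℝ)) * blockCoef β B else 0) := by
    unfold hyb; rw [sum_ite_mem, univ_inter]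
  have ehybU : hyb (univ : Finset (Finset (Fin (k + 1)))) β =
      ∑ B : Finset (Fin (k + 1)), ((B.card : ℝ) * ((B.card - 1).factorial : ℝ)) * blockCoef β B := rfl
  unfold lam at h0 ⊢
  rw [ehyb]
  rw [ehybU] at h0
  simp only [mem_univ, if_true, one_mul] at h0
  -- termwise comparison
  have hB : ∀ B : Finset (Fin (k + 1)),
      ((B.card : ℝ) * ((B.card - 1).factorial : ℝ)) * blockCoef β B ≤
        (if B ∈ 𝒢 then ((B.card : ℝ) * ((B.card - 1).factorial : ℝ)) * blockCoef β B else 0) := by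
    intro B
    split_ifs with hBG
    · exact le_rfl
    · have hBu : B ≠ univ := fun h => hBG (h ▸ htop)
      exact mul_nonpos_of_nonneg_of_nonpos (by positivity) (blockCoef_nonpos_of_zero_one β h01 hsup hBu)
  have ht : ∀ t : Fin (k + 1),
      (if ({t} : Finset (Fin (k + 1))) ∈ 𝒢 then (1 : ℝ) else 0) * phiSet (k + 1) (fun S => if t ∈ S then 1 else β S) ≤
        phiSet (k + 1) (fun S => if t ∈ S then 1 else β S) := by
    intro t
    have hc : 0 ≤ phiSet (k + 1) (fun S => if t ∈ S then 1 else β S) := HSharp.phiSet_capAt_nonneg β h1 t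
    split_ifs
    · rw [one_mul]
    · rw [zero_mul]; exact hc
  have s1 := sum_le_sum fun B (_ : B ∈ (univ : Finset (Finset (Fin (k + 1))))) => hB B
  have s2 := sum_le_sum fun t (_ : t ∈ (univ : Finset (Fin (k + 1)))) => ht t
  linarith

/-- **SDH♭ at the vertices, packaged as the Dirac-mixture case of `SDHFlatNonneg`**: for a single union-closed family `𝒱` with weight one (even
`univ ∈ 𝒱` is not needed) and any `𝒢 ∋ univ`. [this work] -/
theorem sdhFlat_dirac (𝒱 : Finset (Finset (Fin (k + 1)))) (hV : ∀ A ∈ 𝒱, ∀ A' ∈ 𝒱, A ∪ A' ∈ 𝒱)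
    (𝒢 : Finset (Finset (Fin (k + 1)))) (htop : univ ∈ 𝒢) :
    0 ≤ lam 𝒢 (fun S => ∑ _x : Unit, (1 : ℝ) * (if S ∈ 𝒱 then (1 : ℝ) else 0)) := by
  have e : (fun S : Finset (Fin (k + 1)) => ∑ _x : Unit, (1 : ℝ) * (if S ∈ 𝒱 then (1 : ℝ) else 0)) =
      fun S => if S ∈ 𝒱 then (1 : ℝ) else 0 := by
    funext S; simp
  rw [e]
  refine lam_nonneg_of_zero_one 𝒢 htop _ (fun B => by by_cases h : B ∈ 𝒱 <;> simp [h]) fun S T => ?_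
  by_cases hS : S ∈ 𝒱
  · by_cases hT : T ∈ 𝒱
    · rw [if_pos hS, if_pos hT, if_pos (hV S hS T hT)]; norm_num
    · rw [if_neg hT, mul_zero]; split_ifs <;> norm_num
  · rw [if_neg hS, zero_mul]; split_ifs <;> norm_num

/-! ### APPENDED (gen 18, late): the H♯ and H♭ functionals as `d`-weighted sums of honest sub-functionals (kernel form of gen 17's "third form of H♯")

Subtracting `(k+1)Φ(β) = Σ_B |B|(|B|−1)!·β_B·κ_B(β)` from `Σ_t Φ(cap_t β) = Σ_B |B|(|B|−1)!·κ_B(β)` gives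
**`(k+1)·Φ(β) − Σ_t Φ(cap_t β) = −Σ_B |B|(|B|−1)!·(1 − β_B)·κ_B(β)`**, i.e. with `d = 1 − β` and `κ_B = −Φ_{Bᶜ}(β|)` for `B ≠ univ`:
H♯(k+1) at `β` ⟺ `Σ_{B ≠ univ} |B|!·d_B·Φ_{Bᶜ}(β|_{Bᶜ}) ≥ 0` (gen 17, memo §3, now a kernel identity), and likewise for H♭ with the extra singleton weights. -/

/-- **The H♯ functional as a sum over blocks**: `(k+1)·Φ_{k+1}(β) − Σ_t Φ_{k+1}(cap_t β) = −Σ_B |B|(|B|−1)!·(1 − β_B)·κ_B(β)`. [this work] -/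
theorem hSharp_lhs_eq_sum_blockCoef (β : Finset (Fin (k + 1)) → ℝ) :
    ((k + 1 : ℕ) : ℝ) * phiSet (k + 1) β - ∑ t : Fin (k + 1), phiSet (k + 1) (fun S => if t ∈ S then 1 else β S) =
      -∑ B : Finset (Fin (k + 1)), ((B.card : ℝ) * ((B.card - 1).factorial : ℝ)) * ((1 - β B) * blockCoef β B) := by
  rw [k_mul_phiSet_eq_sum_blockCoef, ← hyb_univ_eq_sum_caps]
  unfold hyb
  rw [← sum_sub_distrib, ← sum_neg_distrib]
  refine sum_congr rfl fun B _ => ?_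
  ring

/-- **The H♭ functional as a sum over blocks**: `(k+1)·Φ(β) − Σ_t β_{t}·Φ(cap_t β) = −Σ_B |B|(|B|−1)!·(1 − β_B)·κ_B(β) + Σ_t (1 − β_{t})·Φ(cap_t β)`. [this work] -/
theorem hFlat_lhs_eq_sum_blockCoef (β : Finset (Fin (k + 1)) → ℝ) :
    ((k + 1 : ℕ) : ℝ) * phiSet (k + 1) β - ∑ t : Fin (k + 1), β {t} * phiSet (k + 1) (fun S => if t ∈ S then 1 else β S) =
      -∑ B : Finset (Fin (k + 1)), ((B.card : ℝ) * ((B.card - 1).factorial : ℝ)) * ((1 - β B) * blockCoef β B) +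
        ∑ t : Fin (k + 1), (1 - β {t}) * phiSet (k + 1) (fun S => if t ∈ S then 1 else β S) := by
  rw [← hSharp_lhs_eq_sum_blockCoef, sub_add, ← sum_sub_distrib]
  congr 1
  refine sum_congr rfl fun t _ => ?_
  ring

end SDHFlat

end Summit.CriticalPhenomena.PercolationContinuityZ3.Theorems
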